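import Literature.NumberTheory.DiophantineGeometry.AbcDarmonGranvilleSignatureReduction
import Literature.NumberTheory.DiophantineGeometry.BelyiComposition
import Literature.NumberTheory.DiophantineGeometry.BelyiDegreeGenusZero
import HarnessLib

/-!
# The Fermat function field `uⁿ + gⁿ = 1` as a covering of signature `(n, n, n)`

Topic: `Literature/NumberTheory/DiophantineGeometry`. Theorem-only file (no definition, no named
fact) in the chain attached to the named fact `AbcWave0.darmonGranville1995_thm_2`
(Darmon–Granville 1995, Theorem 2). The tree proves Theorem 2 from Faltings' theorem and, for each
(minimal) hyperbolic signature `(p, q, r)`, a covering of `ℙ¹` over a number field with ramification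
exactly `(p, q, r)` over `0, 1, ∞` and unramified elsewhere
(`darmonGranville1995_thm_2_of_minimal_belyiMaps_of_faltings`, `AbcDarmonGranvilleSignatureReduction`;
in the printed proof this covering comes from the Riemann existence theorem,
[cite: DarmonGranville1995, Prop. 3.1 (p. 525)], [cite: BombieriGubler2006, Cor. 12.6.7]). This
file constructs that covering EXPLICITLY for the signatures `(n, n, n)`, `n ≥ 1`, over any field `K`
of characteristic `0`, in the tree's function-field language and in exactly the shape consumed by
the reduction (so that shape is not vacuous): the **Fermat function field** `F = K(u)(g)`,
`gⁿ = 1 - uⁿ`, with the function `f = uⁿ`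
(`AlgFunctionField.exists_belyiMap_fermat_signature`). As in the classical picture of the Fermat
curve `Xⁿ + Yⁿ = Zⁿ → ℙ¹`, `(X : Y : Z) ↦ (Xⁿ : Zⁿ)`:

* every zero of `f` has order `n` (`K(u)(g)/K(u)` is unramified above `u = 0`, where `1 - uⁿ` is a
  unit and an `n`-th power residue class-wise; `fermat_ord_eq_of_ord_pos`);
* every zero of `f - 1 = -gⁿ` has order `n` (`v_Q(g) = 1` there: `n v_Q(g) = e(Q|P) ≤ [F : K(u)] ≤ n`
  with `v_P(1 - uⁿ) = 1` downstairs; `fermat_ord_sub_one_eq_of_ord_pos`);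
* every pole of `f` has order `n` (`(g/u)ⁿ = u⁻ⁿ - 1` is a unit at `u = ∞`; `fermat_ord_eq_of_ord_neg`);
* `F/K(f)` is unramified over every closed point `π₀ ∉ {X, X - 1}` of the `f`-line: `π₀(uⁿ)` is
  separable in `K[u]` and prime to `1 - uⁿ` (`fermat_ord_aeval_eq_one`);
* `F` has a rational place (above `u = 1`), so `K` is its full constant field
  (`fermat_exists_isRational`).

The tools are the tree's Kummer/Abhyankar lemma for `n`-th roots of units
(`PlaceOver.ord_algebraMap_uniformizer_eq_one_of_pow_eq_of_ord_eq_zero`, `FunctionFieldRadicalBaseChange`),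
`v_Q = e(Q|P) · v_P` (`PlaceOver.ord_algebraMap_eq_mul`), `e ≤ [F' : F]`
(`PlaceOver.ord_algebraMap_uniformizer_le_finrank`), the degree formula `[F : K(β(f))] = deg β · [F : K(f)]`
(`finrank_adjoin_aeval`) and Stichtenoth's inequality `Σ v_P(x) deg P ≤ [F : K(x)]`
(`sum_ord_mul_degree_le_finrank_int`); on the line `K(u)` they give `v_P(h(u)) = 1` for separable `h`
(`PlaceOver.ord_aeval_eq_one_of_separable_of_finrank_eq_one`).

Consequences for Darmon–Granville's theorem (modulo Faltings' theorem ONLY, no Riemann existence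
theorem): `A xⁿ + B yⁿ = C zⁿ` has finitely many proper solutions for `n ≥ 4`
(`finite_properSolutions_fermat_signature_of_faltings`), and so has `A x^p + B y^q = C z^r` whenever
some `n ≥ 4` divides `p`, `q` and `r` (`finite_properSolutions_of_common_dvd_of_faltings`, by the
divisibility reduction `finite_properSolutions_of_dvd`). (For these signatures Faltings' theorem applied
to the twisted Fermat curve itself would of course do; the point is the instance of the covering
input.) [cite: DarmonGranville1995, Theorem 2 (p. 515) and Prop. 3.1 (p. 525)]

## References

* H. Darmon, A. Granville, *On the equations `z^m = F(x, y)` and `A x^p + B y^q = C z^r`*, Bull. London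
  Math. Soc. 27 (1995) 513–543: Theorem 2 (p. 515), Prop. 3.1 (p. 525). [DarmonGranville1995]
* E. Bombieri, W. Gubler, *Heights in Diophantine Geometry*, CUP 2006: Cor. 12.6.7, Example 12.6.? —
  only Cor. 12.6.7 and Thm. 12.6.15 are used. [BombieriGubler2006]
* H. Stichtenoth, *Algebraic Function Fields and Codes*, GTM 254, 2009: Thm. 1.4.11, Thm. 3.1.11,
  Prop. 3.7.3 (Kummer extensions), Example 6.3 (Fermat function fields). [Stichtenoth2009]
-/

noncomputable section

open scoped Classical Polynomial IntermediateField NumberField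

namespace Literature.NumberTheory.DiophantineGeometry

open Polynomial IsDedekindDomain NumberField WithZero

universe u v

namespace AlgFunctionField

/-! ### A. Places of a line `F = K(u)`: separable polynomials in `u` have simple zeros -/

section Line

variable {K : Type u} {F : Type v} [Field K] [Field F] [Algebra K F] [IsAlgFunctionField K F]

/-- **On a line, separable polynomials have simple zeros.** Let `F/K` be a function field generated by
one element `u` (`[F : K(u)] = 1`), `h ∈ K[X]` separable and `P` a place with `v_P(h(u)) > 0`. Then
`v_P(h(u)) = 1`. Proof: `u ∈ 𝒪_P`, the minimal polynomial `ρ` of `ū ∈ F_P` divides `h = ρ σ` with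
`σ(ū) ≠ 0` (separability), so `v_P(h(u)) = v_P(ρ(u))`; and `v_P(ρ(u)) · deg P ≤ [F : K(ρ(u))] =
deg ρ · [F : K(u)] = deg ρ ≤ deg P` (Stichtenoth Thm. 1.4.11 and `finrank_adjoin_aeval`).
[cite: Stichtenoth2009, Thm. 1.4.11] -/
theorem PlaceOver.ord_aeval_eq_one_of_separable_of_finrank_eq_one {u : F} (hu : Transcendental K u)
    (hu1 : Module.finrank K⟮u⟯ F = 1) {h : K[X]} (hsep : h.Separable) (P : PlaceOver K F)
    (hP : 0 < P.ord (aeval u h)) : P.ord (aeval u h) = 1 := by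
  classical
  have hz0 : aeval u h ≠ 0 := by
    intro h0; rw [h0, PlaceOver.ord_zero] at hP; exact lt_irrefl _ hP
  -- `h` is not constant
  have hdeg : 0 < h.natDegree := by
    by_contra hd
    have hd0 : h.natDegree = 0 := by omega
    have hc : h = C (h.coeff 0) := eq_C_of_natDegree_eq_zero hd0
    have hc0 : h.coeff 0 ≠ 0 := by
      intro h00; apply hz0; rw [hc, h00, map_zero, map_zero]
    rw [hc, aeval_C, PlaceOver.ord_algebraMap_holds P hc0] at hP
    exact lt_irrefl _ hP
  have huO : u ∈ P.toValuationSubring := P.mem_of_ord_aeval_pos hdeg hP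
  set ub : P.residueField := IsLocalRing.residue P.toValuationSubring ⟨u, huO⟩ with hub
  have hroot : aeval ub h = 0 := (P.ord_aeval_pos_iff huO hz0).1 hP
  have halg : IsAlgebraic K ub := ⟨h, hsep.ne_zero, hroot⟩
  have hint : IsIntegral K ub := halg.isIntegral
  set ρ : K[X] := minpoly K ub with hρ
  have hρm : ρ.Monic := minpoly.monic hint
  have hρdeg : 0 < ρ.natDegree := minpoly.natDegree_pos hint
  obtain ⟨σ, hσ⟩ : ρ ∣ h := minpoly.dvd K ub hroot
  have hsep' : (ρ * σ).Separable := by rw [← hσ]; exact hsep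
  have hcop : IsCoprime ρ σ := hsep'.isCoprime
  have hρσ : aeval u h = aeval u ρ * aeval u σ := by rw [hσ, map_mul]
  have hρu0 : aeval u ρ ≠ 0 := fun h0 => hz0 (by rw [hρσ, h0, zero_mul])
  have hσu0 : aeval u σ ≠ 0 := fun h0 => hz0 (by rw [hρσ, h0, mul_zero])
  -- `σ(ū) ≠ 0`: `σ(u)` is a unit at `P`
  have hσub : aeval ub σ ≠ 0 := by
    intro h0
    obtain ⟨a, b, hab⟩ := hcop
    have h1 := congr_arg (aeval ub) hab
    rw [map_add, map_mul, map_mul, minpoly.aeval, h0, mul_zero, mul_zero, add_zero, map_one] at h1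
    exact zero_ne_one h1
  have hordσ : P.ord (aeval u σ) = 0 := by
    have hnn := P.ord_nonneg_of_mem (P.aeval_mem huO σ)
    have hnp : ¬ 0 < P.ord (aeval u σ) := fun hpos =>
      hσub ((P.ord_aeval_pos_iff huO hσu0).1 hpos)
    omega
  have hordρ : 0 < P.ord (aeval u ρ) := by
    have hm := P.ord_mul_eq hρu0 hσu0
    rw [← hρσ] at hm
    omega
  -- `deg P ≥ deg ρ`
  haveI : FiniteDimensional K P.residueField := PlaceOver.finiteDimensional_residueField_holds P
  have hdegP : ρ.natDegree ≤ P.degree := by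
    show ρ.natDegree ≤ Module.finrank K P.residueField
    exact minpoly.natDegree_le ub
  -- `v_P(ρ(u)) · deg P ≤ [F : K(ρ(u))] = deg ρ · [F : K(u)] = deg ρ`
  have hρt : Transcendental K (aeval u ρ) :=
    hu.aeval ρ hρdeg.ne' (mem_nonZeroDivisors_of_ne_zero (by rw [hρm.leadingCoeff]; exact one_ne_zero))
  have h1 := sum_ord_mul_degree_le_finrank_int hρt {P} (by simpa using hordρ)
  rw [Finset.sum_singleton, finrank_adjoin_aeval hu hρdeg, hu1, mul_one] at h1
  have hle : P.ord (aeval u ρ) ≤ 1 := by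
    by_contra hgt
    have hdP : (ρ.natDegree : ℤ) ≤ P.degree := by exact_mod_cast hdegP
    have h2 : (2 : ℤ) * ρ.natDegree ≤ P.ord (aeval u ρ) * (P.degree : ℤ) := by nlinarith
    omega
  rw [hρσ, P.ord_mul_eq hρu0 hσu0, hordσ, add_zero]
  omega

/-- On a line `F = K(u)`, every zero of `u` is simple: `v_P(u) > 0 ⇒ v_P(u) = 1`. [folklore] -/
theorem PlaceOver.ord_eq_one_of_finrank_eq_one {u : F} (hu : Transcendental K u)
    (hu1 : Module.finrank K⟮u⟯ F = 1) (P : PlaceOver K F) (hP : 0 < P.ord u) : P.ord u = 1 := by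
  have h := P.ord_aeval_eq_one_of_separable_of_finrank_eq_one hu hu1 separable_X
    (by rwa [aeval_X])
  rwa [aeval_X] at h

/-- On a line `F = K(u)`, every pole of `u` is simple: `v_P(u) < 0 ⇒ v_P(u) = -1`. [folklore] -/
theorem PlaceOver.ord_eq_neg_one_of_finrank_eq_one {u : F} (hu : Transcendental K u)
    (hu1 : Module.finrank K⟮u⟯ F = 1) (P : PlaceOver K F) (hP : P.ord u < 0) : P.ord u = -1 := by
  have hu0 : u ≠ 0 := fun h => hu (h ▸ isAlgebraic_zero)
  have hui : Transcendental K u⁻¹ := fun h => hu (IsAlgebraic.inv_iff.1 h)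
  have hu1' : Module.finrank K⟮u⁻¹⟯ F = 1 := by rw [finrank_adjoin_inv]; exact hu1
  have h := PlaceOver.ord_eq_one_of_finrank_eq_one hui hu1' P (by rw [P.ord_inv hu0]; omega)
  rw [P.ord_inv hu0] at h
  omega

end Line

/-! ### B. Radical extensions `F' = F(g)`, `gⁿ = f`: two bookkeeping lemmas -/

section Radical

variable {F : Type u} {F' : Type v} [Field F] [Field F'] [Algebra F F']

/-- Rescaling a generator by a non-zero constant of the base: `F(c g) = F(g) = F'`. [folklore] -/
theorem adjoin_algebraMap_mul_eq_top {y : F'} (hy : F⟮y⟯ = ⊤) {c : F} (hc : c ≠ 0) :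
    F⟮algebraMap F F' c * y⟯ = ⊤ := by
  rw [eq_top_iff, ← hy, IntermediateField.adjoin_simple_le_iff]
  have hmem : algebraMap F F' c * y ∈ F⟮algebraMap F F' c * y⟯ :=
    IntermediateField.mem_adjoin_simple_self F _
  have hc' : algebraMap F F' c⁻¹ ∈ F⟮algebraMap F F' c * y⟯ := IntermediateField.algebraMap_mem _ _
  have heq : y = algebraMap F F' c⁻¹ * (algebraMap F F' c * y) := by
    rw [← mul_assoc, ← map_mul, inv_mul_cancel₀ hc, map_one, one_mul]
  have key := mul_mem hc' hmem
  rwa [← heq] at key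

/-- `[F(g) : F] ≤ n` when `gⁿ ∈ F` (`n ≥ 1`): the minimal polynomial of `g` divides `Xⁿ - gⁿ`.
[folklore] -/
theorem finrank_le_of_pow_eq_of_adjoin_eq_top {g : F'} {n : ℕ} (hn : 0 < n) {f : F}
    (hg : g ^ n = algebraMap F F' f) (hgen : F⟮g⟯ = ⊤) : Module.finrank F F' ≤ n := by
  have hroot : aeval g (X ^ n - C f) = 0 := by
    rw [map_sub, map_pow, aeval_X, aeval_C, hg, sub_self]
  have hne : (X ^ n - C f : F[X]) ≠ 0 := X_pow_sub_C_ne_zero hn f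
  have hint : IsIntegral F g := ⟨X ^ n - C f, monic_X_pow_sub_C f hn.ne', by rwa [← aeval_def]⟩
  have h1 : Module.finrank F F⟮g⟯ = (minpoly F g).natDegree := IntermediateField.adjoin.finrank hint
  have h2 : (minpoly F g).natDegree ≤ n := by
    have := natDegree_le_of_dvd (minpoly.dvd F g hroot) hne
    rwa [natDegree_X_pow_sub_C] at this
  have h3 : Module.finrank F F' = Module.finrank F F⟮g⟯ := by
    rw [hgen, IntermediateField.finrank_top']
  omega

end Radical

/-! ### C. The polynomials `π₀(Xⁿ)` -/

section Poly

variable {K : Type u} [Field K]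

/-- `π₀(Xⁿ)` is prime to `1 - Xⁿ` as soon as `π₀(1) ≠ 0`: indeed `Xⁿ - 1 ∣ π₀(Xⁿ) - π₀(1)`.
[folklore] -/
theorem isCoprime_comp_X_pow_one_sub_X_pow {π₀ : K[X]} (h1 : π₀.eval 1 ≠ 0) (n : ℕ) :
    IsCoprime (π₀.comp (X ^ n)) (1 - X ^ n) := by
  have hdvd : X ^ n - 1 ∣ π₀.comp (X ^ n) - C (π₀.eval 1) := by
    have h0 : X - C 1 ∣ π₀ - C (π₀.eval 1) := by
      rw [dvd_iff_isRoot, IsRoot, eval_sub, eval_C, sub_self]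
    have h := map_dvd (compRingHom (X ^ n : K[X])) h0
    simpa using h
  obtain ⟨k, hk⟩ := hdvd
  have heq : π₀.comp (X ^ n) = C (π₀.eval 1) + k * (X ^ n - 1) := by linear_combination hk
  have hunit : IsCoprime (C (π₀.eval 1)) (X ^ n - 1) :=
    ⟨C (π₀.eval 1)⁻¹, 0, by rw [zero_mul, add_zero, ← C_mul, inv_mul_cancel₀ h1, C_1]⟩
  have h2 : IsCoprime (π₀.comp (X ^ n)) (X ^ n - 1) := by
    rw [heq]; exact hunit.add_mul_right_left k
  have h3 : (1 - X ^ n : K[X]) = -(X ^ n - 1) := by ring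
  rw [h3]
  exact h2.neg_right

/-- `π₀(Xⁿ)` is separable when `π₀` is separable, `π₀(0) ≠ 0` and `n ≠ 0` in `K`:
its derivative `n Xⁿ⁻¹ π₀'(Xⁿ)` is prime to it. [folklore] -/
theorem separable_comp_X_pow {π₀ : K[X]} (hsep : π₀.Separable) (h0 : π₀.eval 0 ≠ 0) {n : ℕ}
    (hn : (n : K) ≠ 0) : (π₀.comp (X ^ n)).Separable := by
  have hn0 : n ≠ 0 := by rintro rfl; exact hn Nat.cast_zero
  rw [separable_def, derivative_comp, derivative_X_pow]
  refine IsCoprime.mul_right (IsCoprime.mul_right ?_ ?_) ?_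
  · exact ⟨0, C (n : K)⁻¹, by rw [zero_mul, zero_add, ← C_mul, inv_mul_cancel₀ hn, C_1]⟩
  · refine IsCoprime.pow_right ?_
    have hdvd : X ∣ π₀.comp (X ^ n) - C (π₀.eval 0) := by
      rw [X_dvd_iff, coeff_sub, coeff_C_zero, coeff_zero_eq_eval_zero, eval_comp, eval_pow, eval_X,
        zero_pow hn0, sub_self]
    obtain ⟨k, hk⟩ := hdvd
    have heq : π₀.comp (X ^ n) = C (π₀.eval 0) + k * X := by linear_combination hk
    rw [heq]
    have hunit : IsCoprime (C (π₀.eval 0)) (X : K[X]) :=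
      ⟨C (π₀.eval 0)⁻¹, 0, by rw [zero_mul, add_zero, ← C_mul, inv_mul_cancel₀ h0, C_1]⟩
    exact hunit.add_mul_right_left k
  · have h := (separable_def _).1 hsep
    have h' := h.map (compRingHom (X ^ n : K[X]))
    simpa using h'

end Poly

/-! ### D. The Fermat function field `F = K(u)(g)`, `gⁿ = 1 - uⁿ` -/

section FermatField

variable {K : Type u} [Field K]

/-- The coordinate `u = X` of `K(u)` is transcendental over `K`. This is Mathlib's
`RatFunc.transcendental_X`; kept as a deprecated alias (dedup-02495). [folklore] -/
@[deprecated RatFunc.transcendental_X (since := "2026-08-16")]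
theorem transcendental_ratFunc_X : Transcendental K (RatFunc.X : RatFunc K) :=
  RatFunc.transcendental_X

variable [CharZero K]
variable {F : Type u} [Field F] [Algebra (RatFunc K) F] [Algebra K F] [IsScalarTower K (RatFunc K) F]
  [FiniteDimensional (RatFunc K) F] [Algebra.IsSeparable (RatFunc K) F]

/-- **Zeros of `f = uⁿ` have order `n`.** In `F = K(u)(g)`, `gⁿ = 1 - uⁿ`: a place `Q` with
`v_Q(u) > 0` lies over `u = 0`, where `1 - uⁿ` is a unit, so `e(Q | u = 0) = 1` (Kummer:
`PlaceOver.ord_algebraMap_uniformizer_eq_one_of_pow_eq_of_ord_eq_zero`) and `v_Q(u) = v_{u=0}(u) = 1`.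
[cite: Stichtenoth2009, Prop. 3.7.3] -/
theorem fermat_ord_eq_of_ord_pos {n : ℕ} (hn : 0 < n) {g : F}
    (hgp : g ^ n = algebraMap (RatFunc K) F (1 - RatFunc.X ^ n))
    (hgen : IntermediateField.adjoin (RatFunc K) {g} = ⊤) (Q : PlaceOver K F)
    (hQ : 0 < Q.ord (algebraMap (RatFunc K) F RatFunc.X ^ n)) :
    Q.ord (algebraMap (RatFunc K) F RatFunc.X ^ n) = n := by
  haveI : IsAlgFunctionField K F := isAlgFunctionField_of_finiteDimensional (K := K) (F := RatFunc K)
  have hut := RatFunc.transcendental_X (K := K)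
  have hu1 := finrank_adjoin_ratFunc_X (K := K)
  have hnK : (n : K) ≠ 0 := Nat.cast_ne_zero.2 hn.ne'
  have hu0 : (RatFunc.X : RatFunc K) ≠ 0 := RatFunc.X_ne_zero
  have hU0 : algebraMap (RatFunc K) F RatFunc.X ≠ 0 := (_root_.map_ne_zero _).2 hu0
  rw [Q.ord_pow hU0] at hQ ⊢
  have hQU : 0 < Q.ord (algebraMap (RatFunc K) F RatFunc.X) := by
    by_contra hle
    have : (n : ℤ) * Q.ord (algebraMap (RatFunc K) F RatFunc.X) ≤ 0 :=
      mul_nonpos_of_nonneg_of_nonpos (by positivity) (not_lt.1 hle)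
    omega
  set P := Q.restrict (K := K) (F := RatFunc K) with hP
  have hmul := Q.ord_algebraMap_eq_mul (K := K) (F := RatFunc K) (RatFunc.X : RatFunc K)
  have he1 := Q.one_le_ord_algebraMap_uniformizer (K := K) (F := RatFunc K)
  rw [← hP] at hmul he1
  have hPu : 0 < P.ord RatFunc.X := by
    by_contra hle
    have : Q.ord (algebraMap (RatFunc K) F (P.uniformizer : RatFunc K)) * P.ord RatFunc.X ≤ 0 :=
      mul_nonpos_of_nonneg_of_nonpos (by omega) (not_lt.1 hle)
    omega
  have hPu1 : P.ord RatFunc.X = 1 := P.ord_eq_one_of_finrank_eq_one hut hu1 hPu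
  -- `1 - uⁿ` is a unit at `P`
  obtain ⟨hw0, hw⟩ := P.ord_aeval_eq_zero_of_eval_ne_zero hPu (p := 1 - X ^ n) (by simp [hn.ne'])
  have haeval : aeval (RatFunc.X : RatFunc K) (1 - X ^ n : K[X]) = 1 - RatFunc.X ^ n := by simp
  rw [haeval] at hw0 hw
  have he : Q.ord (algebraMap (RatFunc K) F (P.uniformizer : RatFunc K)) = 1 :=
    P.ord_algebraMap_uniformizer_eq_one_of_pow_eq_of_ord_eq_zero hn hnK hw0 hw hgp hgen Q hP.symm
  rw [hmul, he, hPu1, mul_one, mul_one]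

/-- **Poles of `f = uⁿ` have order `n`.** A place `Q` with `v_Q(u) < 0` lies over `u = ∞`, where
`(g/u)ⁿ = u⁻ⁿ - 1` is a unit, so `e(Q | ∞) = 1` and `v_Q(u) = v_∞(u) = -1`.
[cite: Stichtenoth2009, Prop. 3.7.3] -/
theorem fermat_ord_eq_of_ord_neg {n : ℕ} (hn : 0 < n) {g : F}
    (hgp : g ^ n = algebraMap (RatFunc K) F (1 - RatFunc.X ^ n))
    (hgen : IntermediateField.adjoin (RatFunc K) {g} = ⊤) (Q : PlaceOver K F)
    (hQ : Q.ord (algebraMap (RatFunc K) F RatFunc.X ^ n) < 0) :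
    Q.ord (algebraMap (RatFunc K) F RatFunc.X ^ n) = -n := by
  haveI : IsAlgFunctionField K F := isAlgFunctionField_of_finiteDimensional (K := K) (F := RatFunc K)
  have hut := RatFunc.transcendental_X (K := K)
  have hu1 := finrank_adjoin_ratFunc_X (K := K)
  have hnK : (n : K) ≠ 0 := Nat.cast_ne_zero.2 hn.ne'
  have hu0 : (RatFunc.X : RatFunc K) ≠ 0 := RatFunc.X_ne_zero
  have hU0 : algebraMap (RatFunc K) F RatFunc.X ≠ 0 := (_root_.map_ne_zero _).2 hu0
  rw [Q.ord_pow hU0] at hQ ⊢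
  have hQU : Q.ord (algebraMap (RatFunc K) F RatFunc.X) < 0 := by
    by_contra hle
    have : 0 ≤ (n : ℤ) * Q.ord (algebraMap (RatFunc K) F RatFunc.X) :=
      mul_nonneg (by positivity) (not_lt.1 hle)
    omega
  set P := Q.restrict (K := K) (F := RatFunc K) with hP
  have hmul := Q.ord_algebraMap_eq_mul (K := K) (F := RatFunc K) (RatFunc.X : RatFunc K)
  have he1 := Q.one_le_ord_algebraMap_uniformizer (K := K) (F := RatFunc K)
  rw [← hP] at hmul he1
  have hPu : P.ord RatFunc.X < 0 := by
    by_contra hle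
    have : 0 ≤ Q.ord (algebraMap (RatFunc K) F (P.uniformizer : RatFunc K)) * P.ord RatFunc.X :=
      mul_nonneg (by omega) (not_lt.1 hle)
    omega
  have hPu1 : P.ord RatFunc.X = -1 := P.ord_eq_neg_one_of_finrank_eq_one hut hu1 hPu
  -- `u⁻ⁿ - 1 = (g/u)ⁿ` is a unit at `P`
  have hui : 0 < P.ord (RatFunc.X : RatFunc K)⁻¹ := by rw [P.ord_inv hu0]; omega
  obtain ⟨hw0, hw⟩ := P.ord_aeval_eq_zero_of_eval_ne_zero hui (p := X ^ n - 1) (by simp [hn.ne'])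
  have haeval : aeval (RatFunc.X : RatFunc K)⁻¹ (X ^ n - 1 : K[X]) = RatFunc.X⁻¹ ^ n - 1 := by simp
  rw [haeval] at hw0 hw
  have hy : (algebraMap (RatFunc K) F RatFunc.X⁻¹ * g) ^ n =
      algebraMap (RatFunc K) F (RatFunc.X⁻¹ ^ n - 1) := by
    rw [mul_pow, hgp, ← map_pow, ← map_mul, mul_sub, mul_one, ← mul_pow, inv_mul_cancel₀ hu0, one_pow]
  have hygen : IntermediateField.adjoin (RatFunc K) {algebraMap (RatFunc K) F RatFunc.X⁻¹ * g} = ⊤ :=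
    adjoin_algebraMap_mul_eq_top hgen (inv_ne_zero hu0)
  have he : Q.ord (algebraMap (RatFunc K) F (P.uniformizer : RatFunc K)) = 1 :=
    P.ord_algebraMap_uniformizer_eq_one_of_pow_eq_of_ord_eq_zero hn hnK hw0 hw hy hygen Q hP.symm
  rw [hmul, he, hPu1]
  ring

omit [Algebra.IsSeparable (RatFunc K) F] in
/-- **Zeros of `f - 1 = -gⁿ` have order `n`**, i.e. `v_Q(g) = 1` at every zero `Q` of `g`: below
`Q` the place `P` of `K(u)` has `v_P(1 - uⁿ) = 1` (`1 - Xⁿ` is separable), and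
`n · v_Q(g) = v_Q(1 - uⁿ) = e(Q|P) ≤ [F : K(u)] ≤ n`. [cite: Stichtenoth2009, Thm. 3.1.11] -/
theorem fermat_ord_sub_one_eq_of_ord_pos {n : ℕ} (hn : 0 < n) {g : F}
    (hgp : g ^ n = algebraMap (RatFunc K) F (1 - RatFunc.X ^ n))
    (hgen : IntermediateField.adjoin (RatFunc K) {g} = ⊤) (Q : PlaceOver K F)
    (hQ : 0 < Q.ord (algebraMap (RatFunc K) F RatFunc.X ^ n - 1)) :
    Q.ord (algebraMap (RatFunc K) F RatFunc.X ^ n - 1) = n := by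
  haveI : IsAlgFunctionField K F := isAlgFunctionField_of_finiteDimensional (K := K) (F := RatFunc K)
  have hut := RatFunc.transcendental_X (K := K)
  have hu1 := finrank_adjoin_ratFunc_X (K := K)
  have hnK : (n : K) ≠ 0 := Nat.cast_ne_zero.2 hn.ne'
  have hrel : algebraMap (RatFunc K) F RatFunc.X ^ n - 1 = -(g ^ n) := by
    rw [hgp, map_sub, map_one, map_pow]; ring
  have hg0 : g ≠ 0 := by
    intro h0
    rw [hrel, h0, zero_pow hn.ne', neg_zero, PlaceOver.ord_zero] at hQ
    exact lt_irrefl _ hQ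
  rw [hrel, Q.ord_neg, Q.ord_pow hg0] at hQ ⊢
  -- `n v_Q(g) = e(Q|P) · v_P(1 - uⁿ)`
  set P := Q.restrict (K := K) (F := RatFunc K) with hP
  have hmul := Q.ord_algebraMap_eq_mul (K := K) (F := RatFunc K) (1 - RatFunc.X ^ n : RatFunc K)
  have he1 := Q.one_le_ord_algebraMap_uniformizer (K := K) (F := RatFunc K)
  have hele := PlaceOver.ord_algebraMap_uniformizer_le_finrank (K := K) (F := RatFunc K) (P' := Q)
    (P := P) hP.symm
  rw [← hP] at hmul he1
  rw [← hgp, Q.ord_pow hg0] at hmul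
  have hfin : Module.finrank (RatFunc K) F ≤ n := finrank_le_of_pow_eq_of_adjoin_eq_top hn hgp hgen
  have hPpos : 0 < P.ord (1 - RatFunc.X ^ n) := by
    by_contra hle
    have : Q.ord (algebraMap (RatFunc K) F (P.uniformizer : RatFunc K)) *
        P.ord (1 - RatFunc.X ^ n) ≤ 0 :=
      mul_nonpos_of_nonneg_of_nonpos (by omega) (not_lt.1 hle)
    omega
  -- `v_P(1 - uⁿ) = 1` on the line
  have hsep : (1 - X ^ n : K[X]).Separable :=
    (separable_X_pow_sub_C (1 : K) hnK one_ne_zero).of_dvd ⟨-1, by rw [C_1]; ring⟩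
  have haeval : aeval (RatFunc.X : RatFunc K) (1 - X ^ n : K[X]) = 1 - RatFunc.X ^ n := by simp
  have hP1 : P.ord (1 - RatFunc.X ^ n) = 1 := by
    have h := P.ord_aeval_eq_one_of_separable_of_finrank_eq_one hut hu1 hsep (by rwa [haeval])
    rwa [haeval] at h
  rw [hP1, mul_one] at hmul
  have hfin' : (Module.finrank (RatFunc K) F : ℤ) ≤ n := by exact_mod_cast hfin
  have hg1 : Q.ord g ≤ 1 := by
    by_contra hgt
    have : (2 : ℤ) * n ≤ (n : ℤ) * Q.ord g := by nlinarith
    omega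
  have hgpos : 0 < Q.ord g := by
    by_contra hle
    have : (n : ℤ) * Q.ord g ≤ 0 := mul_nonpos_of_nonneg_of_nonpos (by positivity) (not_lt.1 hle)
    omega
  have hg1' : Q.ord g = 1 := le_antisymm hg1 hgpos
  rw [hg1', mul_one]

/-- **`F/K(f)` is unramified away from `0, 1, ∞`.** For `π₀ ∈ K[X]` monic irreducible,
`π₀ ∉ {X, X - 1}`, and a place `Q` with `v_Q(π₀(uⁿ)) > 0`: below `Q`, `v_P(π₀(uⁿ)) = 1` since
`π₀(Xⁿ)` is separable (`separable_comp_X_pow`), and `e(Q|P) = 1` since `1 - uⁿ` is a unit at `P`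
(`π₀(Xⁿ)` is prime to `1 - Xⁿ`, `isCoprime_comp_X_pow_one_sub_X_pow`).
[cite: Stichtenoth2009, Prop. 3.7.3] -/
theorem fermat_ord_aeval_eq_one {n : ℕ} (hn : 0 < n) {g : F}
    (hgp : g ^ n = algebraMap (RatFunc K) F (1 - RatFunc.X ^ n))
    (hgen : IntermediateField.adjoin (RatFunc K) {g} = ⊤) {π₀ : K[X]} (hπi : Irreducible π₀)
    (hπm : π₀.Monic) (hπX : π₀ ≠ X) (hπX1 : π₀ ≠ X - 1) (Q : PlaceOver K F)
    (hQ : 0 < Q.ord (aeval (algebraMap (RatFunc K) F RatFunc.X ^ n) π₀)) :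
    Q.ord (aeval (algebraMap (RatFunc K) F RatFunc.X ^ n) π₀) = 1 := by
  haveI : IsAlgFunctionField K F := isAlgFunctionField_of_finiteDimensional (K := K) (F := RatFunc K)
  have hut := RatFunc.transcendental_X (K := K)
  have hu1 := finrank_adjoin_ratFunc_X (K := K)
  have hnK : (n : K) ≠ 0 := Nat.cast_ne_zero.2 hn.ne'
  -- `π₀(uⁿ) = h(u)` with `h = π₀(Xⁿ)`
  have hcomp : aeval (algebraMap (RatFunc K) F RatFunc.X ^ n) π₀ =
      algebraMap (RatFunc K) F (aeval (RatFunc.X : RatFunc K) (π₀.comp (X ^ n))) := by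
    rw [aeval_comp, map_pow, aeval_X, ← map_pow, aeval_algebraMap_apply]
  rw [hcomp] at hQ ⊢
  have h0 : π₀.eval 0 ≠ 0 := fun h0 => hπX (by
    have h := PlaceOver.eq_X_sub_C_of_irreducible_of_eval_eq_zero hπi hπm h0
    rwa [map_zero, sub_zero] at h)
  have h1 : π₀.eval 1 ≠ 0 := fun h1 => hπX1 (by
    have h := PlaceOver.eq_X_sub_C_of_irreducible_of_eval_eq_zero hπi hπm h1
    rwa [map_one] at h)
  have hsep : (π₀.comp (X ^ n)).Separable :=
    separable_comp_X_pow (PerfectField.separable_of_irreducible hπi) h0 hnK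
  have hdeg : 0 < (π₀.comp (X ^ n)).natDegree := by
    rw [natDegree_comp, natDegree_X_pow]
    exact Nat.mul_pos (Irreducible.natDegree_pos hπi) hn
  have hz0 : aeval (RatFunc.X : RatFunc K) (π₀.comp (X ^ n)) ≠ 0 := by
    intro hz
    rw [hz, map_zero, PlaceOver.ord_zero] at hQ
    exact lt_irrefl _ hQ
  -- below `Q`
  set P := Q.restrict (K := K) (F := RatFunc K) with hP
  have hmul := Q.ord_algebraMap_eq_mul (K := K) (F := RatFunc K)
    (aeval (RatFunc.X : RatFunc K) (π₀.comp (X ^ n)))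
  have he1 := Q.one_le_ord_algebraMap_uniformizer (K := K) (F := RatFunc K)
  rw [← hP] at hmul he1
  have hPpos : 0 < P.ord (aeval (RatFunc.X : RatFunc K) (π₀.comp (X ^ n))) := by
    by_contra hle
    have : Q.ord (algebraMap (RatFunc K) F (P.uniformizer : RatFunc K)) *
        P.ord (aeval (RatFunc.X : RatFunc K) (π₀.comp (X ^ n))) ≤ 0 :=
      mul_nonpos_of_nonneg_of_nonpos (by omega) (not_lt.1 hle)
    omega
  have hP1 : P.ord (aeval (RatFunc.X : RatFunc K) (π₀.comp (X ^ n))) = 1 :=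
    P.ord_aeval_eq_one_of_separable_of_finrank_eq_one hut hu1 hsep hPpos
  -- `1 - uⁿ` is a unit at `P`
  have huO : (RatFunc.X : RatFunc K) ∈ P.toValuationSubring := P.mem_of_ord_aeval_pos hdeg hPpos
  have haeval : aeval (RatFunc.X : RatFunc K) (1 - X ^ n : K[X]) = 1 - RatFunc.X ^ n := by simp
  have hw0' : aeval (RatFunc.X : RatFunc K) (1 - X ^ n : K[X]) ≠ 0 := by
    intro hz
    refine hut ⟨1 - X ^ n, fun h00 => ?_, hz⟩
    have h := congr_arg (eval 0) h00
    simp [hn.ne'] at h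
  have hw0 : (1 - RatFunc.X ^ n : RatFunc K) ≠ 0 := by rwa [haeval] at hw0'
  have hw : P.ord (1 - RatFunc.X ^ n) = 0 := by
    have hnn : 0 ≤ P.ord (1 - RatFunc.X ^ n : RatFunc K) := by
      rw [← haeval]; exact P.ord_nonneg_of_mem (P.aeval_mem huO _)
    by_contra hne
    have hpos : 0 < P.ord (aeval (RatFunc.X : RatFunc K) (1 - X ^ n : K[X])) := by
      rw [haeval]; omega
    have r1 := (P.ord_aeval_pos_iff huO hz0).1 hPpos
    have r2 := (P.ord_aeval_pos_iff huO hw0').1 hpos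
    obtain ⟨a, b, hab⟩ := isCoprime_comp_X_pow_one_sub_X_pow h1 n
    have h := congr_arg (aeval (IsLocalRing.residue P.toValuationSubring ⟨RatFunc.X, huO⟩)) hab
    rw [map_add, map_mul, map_mul, r1, r2, mul_zero, mul_zero, add_zero, map_one] at h
    exact zero_ne_one h
  have he : Q.ord (algebraMap (RatFunc K) F (P.uniformizer : RatFunc K)) = 1 :=
    P.ord_algebraMap_uniformizer_eq_one_of_pow_eq_of_ord_eq_zero hn hnK hw0 hw hgp hgen Q hP.symm
  rw [hmul, he, hP1, mul_one]

omit [Algebra.IsSeparable (RatFunc K) F] in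
/-- **A rational place**: above `u = 1` the Fermat function field has a place of degree one. With
`x = u - 1`: `[F : K(x)] = [F : K(u)] ≤ n`, and at a zero `Q` of `x` one has
`n v_Q(g) = v_Q(1 - uⁿ) = v_Q(x)` (the cofactor `1 + u + ⋯ + uⁿ⁻¹` takes the value `n ≠ 0`), so
`n · deg Q ≤ v_Q(x) deg Q ≤ [F : K(x)] ≤ n`. [cite: Stichtenoth2009, Thm. 1.4.11] -/
theorem fermat_exists_isRational {n : ℕ} (hn : 0 < n) {g : F}
    (hgp : g ^ n = algebraMap (RatFunc K) F (1 - RatFunc.X ^ n))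
    (hgen : IntermediateField.adjoin (RatFunc K) {g} = ⊤) :
    ∃ Q : PlaceOver K F, Q.IsRational := by
  haveI : IsAlgFunctionField K F := isAlgFunctionField_of_finiteDimensional (K := K) (F := RatFunc K)
  have hut := RatFunc.transcendental_X (K := K)
  have hu1 := finrank_adjoin_ratFunc_X (K := K)
  have hnK : (n : K) ≠ 0 := Nat.cast_ne_zero.2 hn.ne'
  -- `x = u - 1`, transcendental, `[K(u) : K(x)] = 1`
  have hxt : Transcendental K (RatFunc.X - 1 : RatFunc K) := fun h =>
    hut (by simpa using h.add isAlgebraic_one)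
  have hxt' : Transcendental K (algebraMap (RatFunc K) F (RatFunc.X - 1)) :=
    (transcendental_algebraMap_iff (algebraMap (RatFunc K) F).injective).2 hxt
  have hadj : K⟮(RatFunc.X - 1 : RatFunc K)⟯ = K⟮(RatFunc.X : RatFunc K)⟯ := by
    refine le_antisymm (IntermediateField.adjoin_simple_le_iff.2
      (sub_mem (IntermediateField.mem_adjoin_simple_self K _) (one_mem _)))
      (IntermediateField.adjoin_simple_le_iff.2 ?_)
    have h : (RatFunc.X - 1 : RatFunc K) + 1 ∈ K⟮(RatFunc.X - 1 : RatFunc K)⟯ :=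
      add_mem (IntermediateField.mem_adjoin_simple_self K _) (one_mem _)
    rwa [sub_add_cancel] at h
  have hx1 : Module.finrank K⟮(RatFunc.X - 1 : RatFunc K)⟯ (RatFunc K) = 1 := by rw [hadj]; exact hu1
  haveI : FiniteDimensional K⟮(RatFunc.X - 1 : RatFunc K)⟯ (RatFunc K) :=
    IsAlgFunctionField.finiteDimensional_adjoin_simple hxt
  have htower := PlaceOver.finrank_adjoin_algebraMap_eq_mul (K := K) (F := RatFunc K) (F' := F)
    (RatFunc.X - 1 : RatFunc K)
  rw [hx1, mul_one] at htower
  have hfin : Module.finrank (RatFunc K) F ≤ n := finrank_le_of_pow_eq_of_adjoin_eq_top hn hgp hgen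
  -- a zero `Q` of `x`
  obtain ⟨Q, hQ⟩ := exists_ord_pos_of_transcendental hxt'
  refine ⟨Q, ?_⟩
  have h1 := sum_ord_mul_degree_le_finrank_int hxt' {Q} (by simpa using hQ)
  rw [Finset.sum_singleton, htower] at h1
  -- `n v_Q(g) = v_Q(x)`: `gⁿ = 1 - uⁿ = -(1 + u + ⋯ + uⁿ⁻¹) (u - 1)`
  set s : K[X] := ∑ i ∈ Finset.range n, X ^ i with hs
  have hsU : aeval (algebraMap (RatFunc K) F RatFunc.X) s =
      ∑ i ∈ Finset.range n, algebraMap (RatFunc K) F RatFunc.X ^ i := by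
    rw [hs, map_sum]; simp only [map_pow, aeval_X]
  have hgeom : g ^ n = -(aeval (algebraMap (RatFunc K) F RatFunc.X) s *
      algebraMap (RatFunc K) F (RatFunc.X - 1)) := by
    rw [hsU, map_sub, map_one, geom_sum_mul, hgp, map_sub, map_one, map_pow]
    ring
  have hxpos : 0 < Q.ord (algebraMap (RatFunc K) F RatFunc.X - 1) := by
    rwa [map_sub, map_one] at hQ
  have hs0 : (s.comp (X + C 1)).eval 0 ≠ 0 := by
    rw [eval_comp, eval_add, eval_X, eval_C, zero_add, hs, eval_finsetSum]
    simp only [eval_pow, eval_X, one_pow, Finset.sum_const, Finset.card_range, nsmul_eq_mul, mul_one]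
    exact hnK
  obtain ⟨hsne, hsord⟩ := Q.ord_aeval_eq_zero_of_eval_ne_zero hxpos hs0
  have hscomp : aeval (algebraMap (RatFunc K) F RatFunc.X - 1) (s.comp (X + C 1)) =
      aeval (algebraMap (RatFunc K) F RatFunc.X) s := by
    rw [aeval_comp, map_add, aeval_X, aeval_C, map_one, sub_add_cancel]
  rw [hscomp] at hsne hsord
  have hx0 : algebraMap (RatFunc K) F (RatFunc.X - 1) ≠ 0 := by
    intro h0; rw [h0, PlaceOver.ord_zero] at hQ; exact lt_irrefl _ hQ
  have hg0 : g ≠ 0 := by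
    intro h0
    have h := hgeom
    rw [h0, zero_pow hn.ne', eq_comm, neg_eq_zero] at h
    exact mul_ne_zero hsne hx0 h
  have hkey : (n : ℤ) * Q.ord g = Q.ord (algebraMap (RatFunc K) F (RatFunc.X - 1)) := by
    rw [← Q.ord_pow hg0, hgeom, Q.ord_neg, Q.ord_mul_eq hsne hx0, hsord, zero_add]
  -- count
  have hgpos : 0 < Q.ord g := by
    by_contra hle
    have : (n : ℤ) * Q.ord g ≤ 0 := mul_nonpos_of_nonneg_of_nonpos (by positivity) (not_lt.1 hle)
    omega
  have hdpos : 0 < Q.degree := PlaceOver.degree_pos_holds Q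
  have hfin' : (Module.finrank (RatFunc K) F : ℤ) ≤ n := by exact_mod_cast hfin
  have hd1 : (Q.degree : ℤ) ≤ 1 := by
    by_contra hgt
    have hdp : (0 : ℤ) < Q.degree := by exact_mod_cast hdpos
    have : (2 : ℤ) * n ≤ Q.ord (algebraMap (RatFunc K) F (RatFunc.X - 1)) * (Q.degree : ℤ) := by
      nlinarith
    omega
  show Q.degree = 1
  omega

/-- **The Fermat function field as a covering of signature `(n, n, n)`.** For every field `K` of
characteristic `0` and every `n ≥ 1` there are an algebraic function field `F/K` with full constant
field `K` and `f ∈ F ∖ K` such that every zero of `f` has order `n`, every zero of `f - 1` has order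
`n`, every pole of `f` has order `n`, and `F/K(f)` is unramified over every closed point
`π₀ ∉ {X, X - 1}` of the `f`-line: `F = K(u)(g)` with `gⁿ = 1 - uⁿ` and `f = uⁿ` (the function field
of the Fermat curve `Xⁿ + Yⁿ = Zⁿ` with `(X : Y : Z) ↦ (Xⁿ : Zⁿ)`). This is the shape of the covering
hypothesis of `darmonGranville1995_thm_2_of_belyiMap_of_faltings`
(`AbcDarmonGranvilleBelyiMapReduction`) at the signature `(n, n, n)`.
[cite: Stichtenoth2009, Example 6.3 (Fermat function fields), Prop. 3.7.3]
[cite: DarmonGranville1995, Prop. 3.1 (p. 525), case `p = q = r`] -/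
theorem exists_belyiMap_fermat_signature (K : Type u) [Field K] [CharZero K] {n : ℕ} (hn : 0 < n) :
    ∃ (F : Type u) (_ : Field F) (_ : Algebra K F) (_ : IsAlgFunctionField K F)
      (_ : IsIntegrallyClosedIn K F) (f : F),
      f ∉ Set.range (algebraMap K F) ∧
      (∀ P : PlaceOver K F, 0 < P.ord f → P.ord f = n) ∧
      (∀ P : PlaceOver K F, 0 < P.ord (f - 1) → P.ord (f - 1) = n) ∧
      (∀ P : PlaceOver K F, P.ord f < 0 → P.ord f = -n) ∧
      (∀ π₀ : K[X], Irreducible π₀ → π₀.Monic → π₀ ≠ X → π₀ ≠ X - 1 →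
        ∀ P : PlaceOver K F, 0 < P.ord (aeval f π₀) → P.ord (aeval f π₀) = 1) := by
  haveI : CharZero (RatFunc K) :=
    charZero_of_injective_algebraMap (algebraMap K (RatFunc K)).injective
  obtain ⟨F, _, _, _, _, _, _, g, hgp, hgen⟩ :=
    exists_radical_extension (K := K) (F := RatFunc K) (1 - RatFunc.X ^ n) hn
  haveI hAF : IsAlgFunctionField K F :=
    isAlgFunctionField_of_finiteDimensional (K := K) (F := RatFunc K)
  obtain ⟨Q₁, hQ₁⟩ := fermat_exists_isRational hn hgp hgen
  haveI hIC : IsIntegrallyClosedIn K F := isIntegrallyClosedIn_of_isRational hQ₁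
  have hut := RatFunc.transcendental_X (K := K)
  have hft : Transcendental K (algebraMap (RatFunc K) F RatFunc.X ^ n) :=
    ((transcendental_algebraMap_iff (algebraMap (RatFunc K) F).injective).2 hut).pow hn
  refine ⟨F, inferInstance, inferInstance, hAF, hIC, algebraMap (RatFunc K) F RatFunc.X ^ n,
    ?_, ?_, ?_, ?_, ?_⟩
  · rintro ⟨c, hc⟩
    exact hft (hc ▸ isAlgebraic_algebraMap c)
  · exact fun P hP => fermat_ord_eq_of_ord_pos hn hgp hgen P hP
  · exact fun P hP => fermat_ord_sub_one_eq_of_ord_pos hn hgp hgen P hP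
  · exact fun P hP => fermat_ord_eq_of_ord_neg hn hgp hgen P hP
  · exact fun π₀ hπi hπm hX hX1 P hP => fermat_ord_aeval_eq_one hn hgp hgen hπi hπm hX hX1 P hP

end FermatField

end AlgFunctionField

/-! ### E. Darmon–Granville for the Fermat signatures, modulo Faltings' theorem only -/

section DarmonGranville

open AlgFunctionField

/-- **`A xⁿ + B yⁿ = C zⁿ` has finitely many proper solutions for `n ≥ 4`, assuming Faltings'
theorem** (the named fact `finite_ratPlaces_of_two_le_genus`, for every function field over a number
field): the one-signature form of Darmon–Granville's argument
(`finite_properSolutions_of_belyiMap_of_faltings`) fed with the Fermat function field over `ℚ`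
(`exists_belyiMap_fermat_signature`); `(n, n, n)` is hyperbolic iff `n ≥ 4`.
[cite: DarmonGranville1995, Theorem 2 (p. 515), case `p = q = r = n ≥ 4`] -/
theorem finite_properSolutions_fermat_signature_of_faltings {n : ℕ} (hn : 4 ≤ n)
    (hFaltings : ∀ (K' : Type) [Field K'] (F' : Type) [Field F'] [Algebra K' F'],
      finite_ratPlaces_of_two_le_genus K' F')
    {A B C : ℤ} (hA : A ≠ 0) (hB : B ≠ 0) (hC : C ≠ 0) :
    {t : ℤ × ℤ × ℤ | ({t.1, t.2.1, t.2.2} : Finset ℤ).gcd id = 1 ∧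
      A * t.1 ^ n + B * t.2.1 ^ n = C * t.2.2 ^ n}.Finite := by
  have hH : n * n + n * n + n * n < n * n * n := by nlinarith
  obtain ⟨F, _, _, _, _, f, hf, h₀, h₁, hi, hunr⟩ :=
    exists_belyiMap_fermat_signature ℚ (show 0 < n by omega)
  exact finite_properSolutions_of_belyiMap_of_faltings hH hf h₀ h₁ hi hunr hFaltings hA hB hC

/-- **`A x^p + B y^q = C z^r` has finitely many proper solutions whenever some `n ≥ 4` divides `p`,
`q` and `r` (`p q r ≠ 0`), assuming Faltings' theorem only**: the Fermat case
(`finite_properSolutions_fermat_signature_of_faltings`) and the divisibility reduction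
`finite_properSolutions_of_dvd`. [cite: DarmonGranville1995, Theorem 2 (p. 515)] -/
theorem finite_properSolutions_of_common_dvd_of_faltings {n p q r : ℕ} (hn : 4 ≤ n)
    (hp : n ∣ p) (hq : n ∣ q) (hr : n ∣ r) (hp0 : p ≠ 0) (hq0 : q ≠ 0) (hr0 : r ≠ 0)
    (hFaltings : ∀ (K' : Type) [Field K'] (F' : Type) [Field F'] [Algebra K' F'],
      finite_ratPlaces_of_two_le_genus K' F')
    {A B C : ℤ} (hA : A ≠ 0) (hB : B ≠ 0) (hC : C ≠ 0) :
    {t : ℤ × ℤ × ℤ | ({t.1, t.2.1, t.2.2} : Finset ℤ).gcd id = 1 ∧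
      A * t.1 ^ p + B * t.2.1 ^ q = C * t.2.2 ^ r}.Finite :=
  finite_properSolutions_of_dvd hp hq hr hp0 hq0 hr0
    (finite_properSolutions_fermat_signature_of_faltings hn hFaltings hA hB hC)

end DarmonGranville

end Literature.NumberTheory.DiophantineGeometry
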